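import Summits.BirchSwinnertonDyer.BirchSwinnertonDyer.Theorems.QuadraticBranchSignedControlPlusEtaKuriharaRecordsLocalTorsion01
import Summits.BirchSwinnertonDyer.BirchSwinnertonDyer.Theses.QuadraticBranchSignedControl
import Summits.BirchSwinnertonDyer.Rank1Residual.GaloisImage.JWitnessTowerSurjectivity
import Summits.BirchSwinnertonDyer.Rank1Residual.Additive.GordRankZeroChiBranch
import Summits.BirchSwinnertonDyer.Rank1Residual.X11b.BDPRouteTamagawaSupport
import HarnessLib

/-!
# Route `QuadraticBranchSignedControl` (rung K8, cell `bsd-potss`), crux `PlusEtaLowerInclusion`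
# (item stmt-BirchSwinnertonDyer-19601): the Kurihara cut in SPLIT-PRIME currency — the Tamagawa
# rows of the cut ARE the pairs whose partner `W` has a split multiplicative prime `ℓ` with
# `p ∣ ord_ℓ Δ_min(W)` (a `--supports` file; seat `bsd-potss-k8eta-c1`, gen 8)

HONEST FRAMING (cell `bsd-potss`, run/shared/lean/pub/bsd-potss/; FULL-BSD rank ≤ 1 programme,
tranche 1b, HUMAN RULING D-0036/D-0074; verbatim in every file): the target of record is FULL BSD for
every analytic-rank ≤ 1 curve over `ℚ`; this cell attacks rows B4/B5/B8 (additive potentially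
supersingular primes). Crux 19601 `PlusEtaLowerInclusion` (Kobayashi's Eisenstein inclusion at
`η = ω^{(p−1)/2}` on the tower-onto good supersingular twists = Kato's lower IMC inclusion for the
additive partner) is OPEN class-wide. THIS FILE closes nothing, books nothing, claims `BSD(W,p)` for
no pair.

WHAT. The sibling `…PlusEtaLowerInclusionKuriharaCut` (this seat, p599308) concludes the crux BY NAME
from (K1) Kim 1.11η, (K2) a Σ₁ Kurihara datum on every partner `W` with `p ∤ ∏ c_ℓ(W)`, (K3) (E⁺_η)
on the pairs with `p ∣ ∏ c_ℓ(W)`. For a prime `p ≥ 5` the tree's Kodaira–Néron dichotomy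
(`X11b.dvd_tamagawaProduct_iff_exists_split`: `c_ℓ ≤ 4` unless `ℓ` is split multiplicative, where
`c_ℓ = ord_ℓ Δ_min`) says `p ∣ ∏ c_ℓ(W)` **iff** `W` has a SPLIT multiplicative prime `ℓ` with
`p ∣ ord_ℓ Δ_min(W)`. THIS FILE restates the cut in that geometric currency:

* `tamagawaFree_iff_forall_split` — for a globally minimal `W` and a prime `p ≥ 5`:
  `p ∤ ∏ c_ℓ(W)` iff every split multiplicative prime `ℓ` of `W` has `p ∤ ord_ℓ Δ_min(W)`;
* `plusEtaLowerInclusion_of_kim111_of_kuriharaData_of_splitRows` — the crux BY NAME from (K1), (K2')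
  the Σ₁ Kurihara datum on every tower-onto partner NONE of whose split multiplicative primes has
  `p ∣ ord_ℓ Δ_min(W)`, and (K3') (E⁺_η) at every tower-onto pair whose partner HAS such a prime
  (the Tamagawa rows, now named by one prime `ℓ ≠ p` of `W` — equivalently a multiplicative prime of
  the good twist `V` with `p ∣ ord_ℓ Δ(V) = −ord_ℓ j(V)` that is split for `W = V ⊗ χ_{p*}`).

WHY. It locates the open (K3) rows by a decidable invariant of the minimal model (`ord_ℓ Δ_min` at the
split primes) instead of the Tamagawa product, ties them to the sibling seat's law on the non-onto
rows (k8eta-c2 g11 p586144/p587572: `p ∣ c_v` at every split `v ∤ p` of a 19606 row) and to the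
tower lemma `GaloisImage.hasSurjectiveModNGaloisRep_pow_of_surj_of_jWitness` (a multiplicative prime
with `p ∤ ord j` is what MAKES the tower onto — the (K3) primes are the OTHER multiplicative primes).
CONDITIONAL; nothing booked; skeleton v4 untouched. Design: this file imports the route file DIRECTLY and
NOT the sibling closer (flat Theses cone, `lint.theses-cone`); the fifteen-line composition is therefore
repeated here rather than called. BSD is not proved by any of this.

References: [SilvermanATAEC1994] Cor. IV.9.2(d), Table 4.1; [Kim2022StructureSelmer] Thm. 1.11,
Remark 6.2; [Kobayashi2003] §4 (p. 8).
-/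

set_option autoImplicit false
-- sibling precedent (`…PlusEtaLowerInclusionKuriharaCut.lean`): the directory name repeats the summit name
set_option linter.dupNamespace false

noncomputable section

open scoped Classical

namespace Summit.BirchSwinnertonDyer.BirchSwinnertonDyer.Theorems.PlusEtaKuriharaCut

open CongruenceSubgroup WeierstrassCurve Field Literature.NumberTheory.EllipticCurves
  Literature.NumberTheory.EllipticCurves.ModularForms
  Literature.NumberTheory.GaloisRepresentations
  Literature.NumberTheory.EllipticCurves.Rank1Residual
  Literature.NumberTheory.EllipticCurves.Rank1Residual.Typed
  Summit.BirchSwinnertonDyer.Rank1Residual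
  Summit.BirchSwinnertonDyer.BirchSwinnertonDyer.Theorems
  Summit.BirchSwinnertonDyer.BirchSwinnertonDyer.Theses.QuadraticBranchSignedControl

open Summit.BirchSwinnertonDyer.Rank1Residual.Additive hiding EtaSignedSelmerDualData
  IsQuadraticBranchPlusLFunction IsQuadraticBranchMinusLFunction

/-! ## §1 Tamagawa-`p`-freeness at `p ≥ 5` is a condition on the split multiplicative primes -/

/-- **`p ∤ ∏ c_ℓ(W)` iff no split multiplicative prime `ℓ` of `W` has `p ∣ ord_ℓ Δ_min(W)`**
(`p ≥ 5`, `W/ℚ` globally minimal): the contrapositive packaging of the tree's Kodaira–Néron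
dichotomy `X11b.dvd_tamagawaProduct_iff_exists_split` (`c_ℓ ≤ 4 < p` off the split primes,
`c_ℓ = ord_ℓ Δ_min` at them). [cite: SilvermanATAEC1994, Cor. IV.9.2(d) and Table 4.1] -/
theorem tamagawaFree_iff_forall_split (W : WeierstrassCurve ℚ) [W.IsElliptic] [W.IsGloballyMinimal]
    {p : ℕ} (hp : p.Prime) (h5 : 5 ≤ p) :
    ¬ p ∣ W.tamagawaProduct ↔
      ∀ (ℓ : ℕ) [Fact ℓ.Prime], W.HasSplitMultiplicativeReductionAtPrime ℓ →
        ¬ p ∣ padicValInt ℓ W.minimalDiscriminantInt := by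
  rw [X11b.dvd_tamagawaProduct_iff_exists_split W hp h5]
  constructor
  · intro h ℓ _ hs hd
    exact h ⟨ℓ, inferInstance, hs, hd⟩
  · rintro h ⟨ℓ, _, hs, hd⟩
    exact h ℓ hs hd

/-! ## §2 The Kurihara cut with the Tamagawa rows named by a split prime -/

/-- **THE KURIHARA CUT IN SPLIT-PRIME CURRENCY.** `PlusEtaLowerInclusion` follows from
(K1) `hKim` : Kim 2026 Thm. 1.11 (1) ⟹ (3) at `η` (named fact);
(K2') `hKur` : for every globally minimal partner `W` (`C • W^{(p*)} = V`) of a tower-onto good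
  supersingular `a_p = 0` pair, `p ≥ 5`, NONE of whose split multiplicative primes `ℓ` has
  `p ∣ ord_ℓ Δ_min(W)`: the Σ₁ Kurihara datum of the sibling cut (a parametrisation datum with
  `p ∤ c_D` and `p`-unit period transfer, a cyclic `𝒩₁`-level, surjective characters and a unit
  Kurihara number);
(K3') `hSplit` : (E⁺_η) at every such pair whose partner `W` HAS a split multiplicative prime `ℓ`
  with `p ∣ ord_ℓ Δ_min(W)`.
Proof (= the sibling `plusEtaLowerInclusion_of_kim111_of_kuriharaData_of_tamagawaRows` with
`p ∣ ∏ c_ℓ(W)` translated both ways by `X11b.dvd_tamagawaProduct_iff_exists_split`, repeated here to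
keep the Theses cone flat): minimal model `W` of `V^{(p*)}` turned round by the twist involution,
`ρ̄_{W,p}` onto from the tower at `m = 1`, split on `p ∣ ∏ c_ℓ(W)`, the gen-7 road
`PlusEtaKuriharaT0.etaPair_of_thm111_of_kuriharaUnit` on the free side. CONDITIONAL (three displayed
hypotheses); closes nothing by itself; nothing booked.
[cite: Kim2022StructureSelmer, Thm. 1.11 (PDF p. 8), Remark 6.2]
[cite: SilvermanATAEC1994, Cor. IV.9.2(d)] [cite: Kobayashi2003, §4 Even main conjecture (p. 8)] -/
theorem plusEtaLowerInclusion_of_kim111_of_kuriharaData_of_splitRows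
    (hKim : Kim2026.thm111_etaEisensteinInclusion_of_kuriharaNumber_ne_zero)
    (hKur : ∀ (V : WeierstrassCurve ℚ) [V.IsElliptic] [V.IsGloballyMinimal] (W : WeierstrassCurve ℚ)
      [W.IsElliptic] [W.IsGloballyMinimal] (C : VariableChange ℚ) (p : ℕ) [Fact p.Prime],
      5 ≤ p → C • W.quadraticTwist ((-1) ^ (p / 2) * p) = V → V.HasGoodReductionAtPrime p →
      V.frobeniusTrace p = 0 → (∀ m : ℕ, V.HasSurjectiveModNGaloisRep (p ^ m : ℕ)) →
      (∀ (ℓ : ℕ) [Fact ℓ.Prime], W.HasSplitMultiplicativeReductionAtPrime ℓ →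
        ¬ p ∣ padicValInt ℓ W.minimalDiscriminantInt) →
      ∃ (NW : ℕ) (_ : NeZero NW) (D : ModularParametrizationData W NW),
        ¬ (p : ℤ) ∣ D.maninConstant ∧
        (∃ u : ℚ, ‖(u : ℚ_[p])‖ = 1 ∧ W.realPeriodRat = u * plusPeriod D.f) ∧
        ∃ (n : ℕ) (_ : NeZero n), Kato.IsKolyvaginProduct W p 1 n ∧
          (∀ (ℓ : ℕ) [Fact ℓ.Prime], ℓ ∣ n →
            Nat.card {P : ((WeierstrassCurve.integralModelInt W).map
              (Int.castRingHom (ZMod ℓ))).toAffine.Point // p • P = 0} ≤ p) ∧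
          ∃ ψ : (ℓ : ℕ) → (ZMod ℓ)ˣ →* Multiplicative (ZMod p),
            (∀ ℓ ∈ n.primeFactors, Function.Surjective (ψ ℓ)) ∧ kuriharaNumber D.f p n ψ ≠ 0)
    (hSplit : ∀ (V : WeierstrassCurve ℚ) [V.IsElliptic] [V.IsGloballyMinimal] (W : WeierstrassCurve ℚ)
      [W.IsElliptic] [W.IsGloballyMinimal] (C : VariableChange ℚ) (p : ℕ) [Fact p.Prime],
      5 ≤ p → C • W.quadraticTwist ((-1) ^ (p / 2) * p) = V → V.HasGoodReductionAtPrime p →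
      V.frobeniusTrace p = 0 → (∀ m : ℕ, V.HasSurjectiveModNGaloisRep (p ^ m : ℕ)) →
      ∀ (ℓ : ℕ) [Fact ℓ.Prime], W.HasSplitMultiplicativeReductionAtPrime ℓ →
        p ∣ padicValInt ℓ W.minimalDiscriminantInt → QuadraticBranchPlusEtaLowerInclusionAt V p) :
    PlusEtaLowerInclusion := by
  intro V _ _ p _ h5 hgood hap htower
  have hp : p.Prime := Fact.out
  have hd : ((-1 : ℚ) ^ (p / 2) * p) ≠ 0 :=
    mul_ne_zero (pow_ne_zero _ (by norm_num)) (by exact_mod_cast hp.ne_zero)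
  obtain ⟨W, _, _, C', hC'⟩ := AdditivePotMult.exists_globallyMinimal_model_twist V hd
  obtain ⟨C, hCV⟩ := exists_variableChange_twist_of_model_twist V hd hC'
  by_cases htam : p ∣ W.tamagawaProduct
  · obtain ⟨ℓ, _, hs, hdisc⟩ := (X11b.dvd_tamagawaProduct_iff_exists_split W hp h5).mp htam
    exact hSplit V W C p h5 hCV hgood hap htower ℓ hs hdisc
  · have hsurj : W.HasSurjectiveModNGaloisRep p := by
      simpa only [pow_one] using
        (GaloisImage.hasSurjectiveModNGaloisRep_pow_iff_of_model_twist V p hd ⟨C', hC'⟩ 1).mpr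
          (htower 1)
    obtain ⟨NW, _, D, hc, hper, n, _, hn, hcyc, ψ, hψ, hδ⟩ := hKur V W C p h5 hCV hgood hap htower
      ((tamagawaFree_iff_forall_split W hp h5).mp htam)
    exact (PlusEtaKuriharaT0.etaPair_of_thm111_of_kuriharaUnit hKim W C hCV h5 hsurj htam D hc hper
      n hn hcyc ψ hψ hδ).1

end Summit.BirchSwinnertonDyer.BirchSwinnertonDyer.Theorems.PlusEtaKuriharaCut

end
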